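import Summits.RiemannHypothesis.RiemannHypothesis.Theorems.WeilFormatCTailOddJMS
import Summits.RiemannHypothesis.RiemannHypothesis.Theorems.WeilFormatCTailJointStructured
import HarnessLib

/-!
# Format C, L-C3b (odd sector): the order-`J` tail majorant with the JOINT `A/B` Gram (design "TJ")

Route context: Fourier–Galerkin / Schur-complement certificates of Weil positivity on a window ("format C";
cell memo `run/shared/lean/pub/rh-explicit/rh-explicit-weil-10/FORMATC-DESIGN.md` §9.9.7; supporting
stmt-RiemannHypothesis-0098; seat rh-explicit-weil-10; lead ruling R8-15 (C)).  The odd-sector twin of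
`WeilFormatC.even_tailJJ_majorant`: block rows `k ↦` mode `k+1`, tail columns `l ↦` mode `l+1` (`l ≥ B₃ ≥ 2B`),
families `e^A = 2j+2`, `e^B = 2r+1`, zeta tails from mode `B₃+1` (`WeilFormatC.tailJJ_structured_le` at tail start
`B₃ + 1` after the reindexing `l + 1 = m`).  ONE Peter–Paul parameter `θ`; resonance data `s₁, s₋, s₊` (`0` = crude).
At `a = 1` the minimal exact-column range of the odd block 256 drops from `B₃ = 896` (mean-square form) to `704`
(kit jobs j165366, j167511; `J = 4`).

* `odd_tailJJ_majorant` — functional form (every truncation `N`).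

Standard axioms; no definitions; no RH claim.
-/

set_option autoImplicit false
-- `Summit.RiemannHypothesis.RiemannHypothesis.…` is the layout-mandated namespace (summit = problem name).
set_option linter.dupNamespace false

noncomputable section

open Complex Finset Matrix
open scoped Real BigOperators ArithmeticFunction.vonMangoldt

namespace Summit.RiemannHypothesis.RiemannHypothesis.Theorems.WeilFormatC

open Literature.NumberTheory.LFunctions Literature.NumberTheory.LFunctions.Yoshida1992
open Literature.Analysis.SpecialFunctions

variable {a : ℝ}

/-! ## The tail majorant (joint form) -/

section Tail

-- One declaration carries the per-mode decomposition and the x-level bookkeeping of a statement ≈ 2.5× the size of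
-- `odd_tailJMS_majorant`; the default budget is exceeded by ≈ 30 % (measured), hence the explicit limit.
set_option maxHeartbeats 400000 in
/-- **Odd tail majorant at order `J`, joint `A/B` form.**  See the module docstring. -/
theorem odd_tailJJ_majorant (ha : 0 < a) {B B₃ : ℕ} (hB : 1 ≤ B) (hBB : 2 * B ≤ B₃) (J : ℕ)
    (d : ℕ → ℝ) {d₀ : ℝ} (hd₀ : 0 < d₀) (hd : ∀ l, B₃ ≤ l → d₀ ≤ d l) {θ : ℝ} (hθ : 0 < θ)
    (s₁ : ℕ → ℝ) (sm sp : ℕ → ℕ → ℝ)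
    (hs₁ : ∀ k ∈ weilPrimeIndex a, IsPrimePow k → 0 ≤ s₁ k ∧ s₁ k ≤ |Real.sin (π * Real.log k / a / 2)|)
    (hsm : ∀ k ∈ weilPrimeIndex a, ∀ k' ∈ weilPrimeIndex a, IsPrimePow k → IsPrimePow k' → k ≠ k' →
      0 ≤ sm k k' ∧ sm k k' ≤ |Real.sin ((π * Real.log k / a - π * Real.log k' / a) / 2)|)
    (hsp : ∀ k ∈ weilPrimeIndex a, ∀ k' ∈ weilPrimeIndex a, IsPrimePow k → IsPrimePow k' →
      0 ≤ sp k k' ∧ sp k k' ≤ |Real.sin ((π * Real.log k / a + π * Real.log k' / a) / 2)|)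
    (N : ℕ) (x : Fin B → ℝ) :
    ∑ l ∈ Finset.Ico B₃ N, (∑ k : Fin B,
        ((gramCoeff a (((k : ℕ) : ℤ) + 1) ((l : ℤ) + 1) - gramCoeff a (((k : ℕ) : ℤ) + 1) (-((l : ℤ) + 1))) / 2) * x k) ^ 2 / d l
      ≤ (1 + θ) * (1 / d₀)
          * ((1 + (a * (1 + weilArchDensity (2 * a)) / (π * ((B₃ + 1 : ℕ) : ℝ))) / π) * ((((∑ j : Fin J, ∑ j' : Fin J, (∑ k : Fin B, ((-1 : ℝ) ^ ((k : ℕ) + 1) * (((k : ℕ) : ℝ) + 1) ^ (2 * (j : ℕ) + 1)) * x k) / 4 * ((∑ k : Fin B, ((-1 : ℝ) ^ ((k : ℕ) + 1) * (((k : ℕ) : ℝ) + 1) ^ (2 * (j' : ℕ) + 1)) * x k) / 4) * ((1 / (((2 * (j : ℕ) + 2) + (2 * (j' : ℕ) + 2) - 1 : ℕ) * (B₃ : ℝ) ^ ((2 * (j : ℕ) + 2) + (2 * (j' : ℕ) + 2) - 1)) + 1 / (((2 * (j : ℕ) + 2) + (2 * (j' : ℕ) + 2) - 1 : ℕ) *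 ((B₃ + 1 : ℕ) : ℝ) ^ ((2 * (j : ℕ) + 2) + (2 * (j' : ℕ) + 2) - 1))) / 2))
            + ∑ r' : Fin J, ∑ j : Fin J, (∑ k : Fin B, ((-1 : ℝ) ^ ((k : ℕ) + 1) * (-((((k : ℕ) : ℝ) + 1) ^ (2 * (r' : ℕ))) * ((Complex.digamma (1 / 4 + ((freq a (((k : ℕ) : ℤ) + 1) : ℝ) : ℂ) / 2 * I)).im / 2 + (∑ p ∈ weilPrimeIndex a, (Λ p : ℝ) / Real.sqrt p * Real.sin (freq a (((k : ℕ) : ℤ) + 1) * Real.log p)) - archExpSumSin a (((k : ℕ) : ℤ) + 1)) / π - 4 * (Real.exp (a / 2) - Real.exp (-(a / 2))) ^ 2 / π * (-1 : ℝ) ^ (r' : ℕ) * (a ^ 2 / (4 * π ^ 2)) ^ (r' : ℕ) * (freq a (((k : ℕ) : ℤ) + 1) / (1 + 4 * freq a (((k : ℕ) : ℤ) + 1) ^ 2)))) * x k) * ((∑ k : Fin B, ((-1 : ℝ) ^ ((k : ℕ) + 1) * (((k : ℕ) : ℝ) + 1) ^ (2 * (j : ℕ) + 1)) * x k) / 4)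 * ((1 / (((2 * (r' : ℕ) + 1) + (2 * (j : ℕ) + 2) - 1 : ℕ) * (B₃ : ℝ) ^ ((2 * (r' : ℕ) + 1) + (2 * (j : ℕ) + 2) - 1)) + 1 / (((2 * (r' : ℕ) + 1) + (2 * (j : ℕ) + 2) - 1 : ℕ) * ((B₃ + 1 : ℕ) : ℝ) ^ ((2 * (r' : ℕ) + 1) + (2 * (j : ℕ) + 2) - 1))) / 2))
          + ((∑ j : Fin J, ∑ r' : Fin J, (∑ k : Fin B, ((-1 : ℝ) ^ ((k : ℕ) + 1) * (((k : ℕ) : ℝ) + 1) ^ (2 * (j : ℕ) + 1)) * x k) / 4 * (∑ k : Fin B, ((-1 : ℝ) ^ ((k : ℕ) + 1) * (-((((k : ℕ) : ℝ) + 1) ^ (2 * (r' : ℕ))) * ((Complex.digamma (1 / 4 + ((freq a (((k : ℕ) : ℤ) + 1) : ℝ) : ℂ) / 2 * I)).im / 2 + (∑ p ∈ weilPrimeIndex a, (Λ p : ℝ) / Real.sqrt p * Real.sin (freq a (((k : ℕ) : ℤ) + 1) * Real.log p)) - archExpSumSin a (((k : ℕ) : ℤ) + 1)) / π - 4 * (Real.exp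 (a / 2) - Real.exp (-(a / 2))) ^ 2 / π * (-1 : ℝ) ^ (r' : ℕ) * (a ^ 2 / (4 * π ^ 2)) ^ (r' : ℕ) * (freq a (((k : ℕ) : ℤ) + 1) / (1 + 4 * freq a (((k : ℕ) : ℤ) + 1) ^ 2)))) * x k) * ((1 / (((2 * (j : ℕ) + 2) + (2 * (r' : ℕ) + 1) - 1 : ℕ) * (B₃ : ℝ) ^ ((2 * (j : ℕ) + 2) + (2 * (r' : ℕ) + 1) - 1)) + 1 / (((2 * (j : ℕ) + 2) + (2 * (r' : ℕ) + 1) - 1 : ℕ) * ((B₃ + 1 : ℕ) : ℝ) ^ ((2 * (j : ℕ) + 2) + (2 * (r' : ℕ) + 1) - 1))) / 2))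
            + ∑ r' : Fin J, ∑ r'' : Fin J, (∑ k : Fin B, ((-1 : ℝ) ^ ((k : ℕ) + 1) * (-((((k : ℕ) : ℝ) + 1) ^ (2 * (r' : ℕ))) * ((Complex.digamma (1 / 4 + ((freq a (((k : ℕ) : ℤ) + 1) : ℝ) : ℂ) / 2 * I)).im / 2 + (∑ p ∈ weilPrimeIndex a, (Λ p : ℝ) / Real.sqrt p * Real.sin (freq a (((k : ℕ) : ℤ) + 1) * Real.log p)) - archExpSumSin a (((k : ℕ) : ℤ) + 1)) / π - 4 * (Real.exp (a / 2) - Real.exp (-(a / 2))) ^ 2 / π * (-1 : ℝ) ^ (r' : ℕ) * (a ^ 2 / (4 * π ^ 2)) ^ (r' : ℕ) * (freq a (((k : ℕ) : ℤ) + 1) / (1 + 4 * freq a (((k : ℕ) : ℤ) + 1) ^ 2)))) * x k) * (∑ k : Fin B, ((-1 : ℝ) ^ ((k : ℕ) + 1) * (-((((k : ℕ) : ℝ) + 1) ^ (2 * (r'' : ℕ))) * ((Complex.digamma (1 / 4 + ((freq a (((k : ℕ) : ℤ) + 1) : ℝ) : ℂ) / 2 * I)).im / 2 + (∑ p ∈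 weilPrimeIndex a, (Λ p : ℝ) / Real.sqrt p * Real.sin (freq a (((k : ℕ) : ℤ) + 1) * Real.log p)) - archExpSumSin a (((k : ℕ) : ℤ) + 1)) / π - 4 * (Real.exp (a / 2) - Real.exp (-(a / 2))) ^ 2 / π * (-1 : ℝ) ^ (r'' : ℕ) * (a ^ 2 / (4 * π ^ 2)) ^ (r'' : ℕ) * (freq a (((k : ℕ) : ℤ) + 1) / (1 + 4 * freq a (((k : ℕ) : ℤ) + 1) ^ 2)))) * x k) * ((1 / (((2 * (r' : ℕ) + 1) + (2 * (r'' : ℕ) + 1) - 1 : ℕ) * (B₃ : ℝ) ^ ((2 * (r' : ℕ) + 1) + (2 * (r'' : ℕ) + 1) - 1)) + 1 / (((2 * (r' : ℕ) + 1) + (2 * (r'' : ℕ) + 1) - 1 : ℕ) * ((B₃ + 1 : ℕ) : ℝ) ^ ((2 * (r' : ℕ) + 1) + (2 * (r'' : ℕ) + 1) - 1))) / 2)))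
        + ((((∑ j : Fin J, ((∑ k : Fin B, ((-1 : ℝ) ^ ((k : ℕ) + 1) * (((k : ℕ) : ℝ) + 1) ^ (2 * (j : ℕ) + 1)) * x k) / 4) ^ 2 * ∑ j' : Fin J, ((1 / (((2 * (j : ℕ) + 2) + (2 * (j' : ℕ) + 2) - 1 : ℕ) * (B₃ : ℝ) ^ ((2 * (j : ℕ) + 2) + (2 * (j' : ℕ) + 2) - 1)) - 1 / (((2 * (j : ℕ) + 2) + (2 * (j' : ℕ) + 2) - 1 : ℕ) * ((B₃ + 1 : ℕ) : ℝ) ^ ((2 * (j : ℕ) + 2) + (2 * (j' : ℕ) + 2) - 1))) / 2) * (B : ℝ) ^ (2 * (j' : ℕ) + 2) / (B : ℝ) ^ (2 * (j : ℕ) + 2))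
            + ∑ r' : Fin J, (∑ k : Fin B, ((-1 : ℝ) ^ ((k : ℕ) + 1) * (-((((k : ℕ) : ℝ) + 1) ^ (2 * (r' : ℕ))) * ((Complex.digamma (1 / 4 + ((freq a (((k : ℕ) : ℤ) + 1) : ℝ) : ℂ) / 2 * I)).im / 2 + (∑ p ∈ weilPrimeIndex a, (Λ p : ℝ) / Real.sqrt p * Real.sin (freq a (((k : ℕ) : ℤ) + 1) * Real.log p)) - archExpSumSin a (((k : ℕ) : ℤ) + 1)) / π - 4 * (Real.exp (a / 2) - Real.exp (-(a / 2))) ^ 2 / π * (-1 : ℝ) ^ (r' : ℕ) * (a ^ 2 / (4 * π ^ 2)) ^ (r' : ℕ) * (freq a (((k : ℕ) : ℤ) + 1) / (1 + 4 * freq a (((k : ℕ) : ℤ) + 1) ^ 2)))) * x k) ^ 2 * ∑ j : Fin J, ((1 / (((2 * (r' : ℕ) + 1) + (2 * (j : ℕ) + 2) - 1 : ℕ) * (B₃ : ℝ) ^ ((2 * (r' : ℕ) + 1) + (2 * (j : ℕ) + 2) - 1)) - 1 / (((2 * (r' : ℕ) + 1) + (2 * (j : ℕ) + 2) - 1 :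 ℕ) * ((B₃ + 1 : ℕ) : ℝ) ^ ((2 * (r' : ℕ) + 1) + (2 * (j : ℕ) + 2) - 1))) / 2) * (B : ℝ) ^ (2 * (j : ℕ) + 2) / (B : ℝ) ^ (2 * (r' : ℕ) + 1))
          + ((∑ j : Fin J, ((∑ k : Fin B, ((-1 : ℝ) ^ ((k : ℕ) + 1) * (((k : ℕ) : ℝ) + 1) ^ (2 * (j : ℕ) + 1)) * x k) / 4) ^ 2 * ∑ r' : Fin J, ((1 / (((2 * (j : ℕ) + 2) + (2 * (r' : ℕ) + 1) - 1 : ℕ) * (B₃ : ℝ) ^ ((2 * (j : ℕ) + 2) + (2 * (r' : ℕ) + 1) - 1)) - 1 / (((2 * (j : ℕ) + 2) + (2 * (r' : ℕ) + 1) - 1 : ℕ) * ((B₃ + 1 : ℕ) : ℝ) ^ ((2 * (j : ℕ) + 2) + (2 * (r' : ℕ) + 1) - 1))) / 2) * (B : ℝ) ^ (2 * (r' : ℕ) + 1) / (B : ℝ) ^ (2 * (j : ℕ) + 2))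
            + ∑ r' : Fin J, (∑ k : Fin B, ((-1 : ℝ) ^ ((k : ℕ) + 1) * (-((((k : ℕ) : ℝ) + 1) ^ (2 * (r' : ℕ))) * ((Complex.digamma (1 / 4 + ((freq a (((k : ℕ) : ℤ) + 1) : ℝ) : ℂ) / 2 * I)).im / 2 + (∑ p ∈ weilPrimeIndex a, (Λ p : ℝ) / Real.sqrt p * Real.sin (freq a (((k : ℕ) : ℤ) + 1) * Real.log p)) - archExpSumSin a (((k : ℕ) : ℤ) + 1)) / π - 4 * (Real.exp (a / 2) - Real.exp (-(a / 2))) ^ 2 / π * (-1 : ℝ) ^ (r' : ℕ) * (a ^ 2 / (4 * π ^ 2)) ^ (r' : ℕ) * (freq a (((k : ℕ) : ℤ) + 1) / (1 + 4 * freq a (((k : ℕ) : ℤ) + 1) ^ 2)))) * x k) ^ 2 * ∑ r'' : Fin J, ((1 / (((2 * (r' : ℕ) + 1) + (2 * (r'' : ℕ) + 1) - 1 : ℕ) * (B₃ : ℝ) ^ ((2 * (r' : ℕ) + 1) + (2 * (r'' : ℕ) + 1) - 1)) - 1 / (((2 * (r' : ℕ) + 1) + (2 * (r'' : ℕ) +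 1) - 1 : ℕ) * ((B₃ + 1 : ℕ) : ℝ) ^ ((2 * (r' : ℕ) + 1) + (2 * (r'' : ℕ) + 1) - 1))) / 2) * (B : ℝ) ^ (2 * (r'' : ℕ) + 1) / (B : ℝ) ^ (2 * (r' : ℕ) + 1)))))
        + ((a * (1 + weilArchDensity (2 * a)) / (π * ((B₃ + 1 : ℕ) : ℝ))) / π + ((a * (1 + weilArchDensity (2 * a)) / (π * ((B₃ + 1 : ℕ) : ℝ))) ^ 2 + (∑ k ∈ weilPrimeIndex a, ((Λ k : ℝ) / Real.sqrt k) ^ 2) / 2 + 2 * (a * (1 + weilArchDensity (2 * a)) / (π * ((B₃ + 1 : ℕ) : ℝ))) * (∑ k ∈ weilPrimeIndex a, (Λ k : ℝ) / Real.sqrt k) + ((∑ k ∈ weilPrimeIndex a, ∑ k' ∈ (weilPrimeIndex a).erase k, if sm k k' = 0 then (Λ k : ℝ) / Real.sqrt k * ((Λ k' : ℝ) / Real.sqrt k') else 0) / 2 + (∑ k ∈ weilPrimeIndex a, ∑ k' ∈ weilPrimeIndex a, if sp k k' = 0 then (Λ k : ℝ) / Real.sqrt k * ((Λ k' : ℝ)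 / Real.sqrt k') else 0) / 2)) / π ^ 2) * ((∑ j : Fin J, ∑ j' : Fin J, (∑ k : Fin B, ((-1 : ℝ) ^ ((k : ℕ) + 1) * (((k : ℕ) : ℝ) + 1) ^ (2 * (j : ℕ) + 1)) * x k) * (∑ k : Fin B, ((-1 : ℝ) ^ ((k : ℕ) + 1) * (((k : ℕ) : ℝ) + 1) ^ (2 * (j' : ℕ) + 1)) * x k) * ((1 / (((2 * (j : ℕ) + 2) + (2 * (j' : ℕ) + 2) - 1 : ℕ) * (B₃ : ℝ) ^ ((2 * (j : ℕ) + 2) + (2 * (j' : ℕ) + 2) - 1)) + 1 / (((2 * (j : ℕ) + 2) + (2 * (j' : ℕ) + 2) - 1 : ℕ) * ((B₃ + 1 : ℕ) : ℝ) ^ ((2 * (j : ℕ) + 2) + (2 * (j' : ℕ) + 2) - 1))) / 2))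
          + ∑ j : Fin J, (∑ k : Fin B, ((-1 : ℝ) ^ ((k : ℕ) + 1) * (((k : ℕ) : ℝ) + 1) ^ (2 * (j : ℕ) + 1)) * x k) ^ 2 * ∑ j' : Fin J, ((1 / (((2 * (j : ℕ) + 2) + (2 * (j' : ℕ) + 2) - 1 : ℕ) * (B₃ : ℝ) ^ ((2 * (j : ℕ) + 2) + (2 * (j' : ℕ) + 2) - 1)) - 1 / (((2 * (j : ℕ) + 2) + (2 * (j' : ℕ) + 2) - 1 : ℕ) * ((B₃ + 1 : ℕ) : ℝ) ^ ((2 * (j : ℕ) + 2) + (2 * (j' : ℕ) + 2) - 1))) / 2) * (B : ℝ) ^ (2 * (j' : ℕ) + 2) / (B : ℝ) ^ (2 * (j : ℕ) + 2))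
        + (1 / π ^ 2) * ∑ j : Fin J, (∑ k : Fin B, ((-1 : ℝ) ^ ((k : ℕ) + 1) * (((k : ℕ) : ℝ) + 1) ^ (2 * (j : ℕ) + 1)) * x k) ^ 2 * ∑ j' : Fin J, ((∑ k ∈ weilPrimeIndex a, ∑ k' ∈ (weilPrimeIndex a).erase k, (Λ k : ℝ) / Real.sqrt k * ((Λ k' : ℝ) / Real.sqrt k') / sm k k') / 2 + (∑ k ∈ weilPrimeIndex a, ∑ k' ∈ weilPrimeIndex a, (Λ k : ℝ) / Real.sqrt k * ((Λ k' : ℝ) / Real.sqrt k') / sp k k') / 2) / ((B₃ + 1 : ℕ) : ℝ) ^ ((2 * (j : ℕ) + 2) + (2 * (j' : ℕ) + 2)) * (B : ℝ) ^ (2 * (j' : ℕ) + 2) / (B : ℝ) ^ (2 * (j : ℕ) + 2)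
        + (1 / (2 * π)) * ∑ j : Fin J, (∑ k : Fin B, ((-1 : ℝ) ^ ((k : ℕ) + 1) * (((k : ℕ) : ℝ) + 1) ^ (2 * (j : ℕ) + 1)) * x k) ^ 2 * ∑ j' : Fin J, ((∑ k ∈ weilPrimeIndex a, (Λ k : ℝ) / Real.sqrt k / s₁ k) / ((B₃ + 1 : ℕ) : ℝ) ^ ((2 * (j : ℕ) + 2) + (2 * (j' : ℕ) + 2)) + (∑ k ∈ weilPrimeIndex a, if s₁ k = 0 then (Λ k : ℝ) / Real.sqrt k else 0) * (1 / (((2 * (j : ℕ) + 2) + (2 * (j' : ℕ) + 2) - 1 : ℕ) * (B₃ : ℝ) ^ ((2 * (j : ℕ) + 2) + (2 * (j' : ℕ) + 2) - 1)))) * (B : ℝ) ^ (2 * (j' : ℕ) + 2) / (B : ℝ) ^ (2 * (j : ℕ) + 2)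
        + (1 / π) * ((∑ j : Fin J, (∑ k : Fin B, ((-1 : ℝ) ^ ((k : ℕ) + 1) * (((k : ℕ) : ℝ) + 1) ^ (2 * (j : ℕ) + 1)) * x k) ^ 2 * ∑ r' : Fin J, ((∑ k ∈ weilPrimeIndex a, (Λ k : ℝ) / Real.sqrt k / s₁ k) / ((B₃ + 1 : ℕ) : ℝ) ^ ((2 * (j : ℕ) + 2) + (2 * (r' : ℕ) + 1)) + (∑ k ∈ weilPrimeIndex a, if s₁ k = 0 then (Λ k : ℝ) / Real.sqrt k else 0) * (1 / (((2 * (j : ℕ) + 2) + (2 * (r' : ℕ) + 1) - 1 : ℕ) * (B₃ : ℝ) ^ ((2 * (j : ℕ) + 2) + (2 * (r' : ℕ) + 1) - 1)))) * (B : ℝ) ^ (2 * (r' : ℕ) + 1) / (B : ℝ) ^ (2 * (j : ℕ) + 2))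
          + ∑ r' : Fin J, (∑ k : Fin B, ((-1 : ℝ) ^ ((k : ℕ) + 1) * (-((((k : ℕ) : ℝ) + 1) ^ (2 * (r' : ℕ))) * ((Complex.digamma (1 / 4 + ((freq a (((k : ℕ) : ℤ) + 1) : ℝ) : ℂ) / 2 * I)).im / 2 + (∑ p ∈ weilPrimeIndex a, (Λ p : ℝ) / Real.sqrt p * Real.sin (freq a (((k : ℕ) : ℤ) + 1) * Real.log p)) - archExpSumSin a (((k : ℕ) : ℤ) + 1)) / π - 4 * (Real.exp (a / 2) - Real.exp (-(a / 2))) ^ 2 / π * (-1 : ℝ) ^ (r' : ℕ) * (a ^ 2 / (4 * π ^ 2)) ^ (r' : ℕ) * (freq a (((k : ℕ) : ℤ) + 1) / (1 + 4 * freq a (((k : ℕ) : ℤ) + 1) ^ 2)))) * x k) ^ 2 * ∑ j : Fin J, ((∑ k ∈ weilPrimeIndex a, (Λ k : ℝ) / Real.sqrt k / s₁ k) / ((B₃ + 1 : ℕ) : ℝ) ^ ((2 * (j : ℕ) + 2) + (2 * (r' : ℕ) + 1)) + (∑ k ∈ weilPrimeIndex a, if s₁ k = 0 then (Λ k : ℝ)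 / Real.sqrt k else 0) * (1 / (((2 * (j : ℕ) + 2) + (2 * (r' : ℕ) + 1) - 1 : ℕ) * (B₃ : ℝ) ^ ((2 * (j : ℕ) + 2) + (2 * (r' : ℕ) + 1) - 1)))) * (B : ℝ) ^ (2 * (j : ℕ) + 2) / (B : ℝ) ^ (2 * (r' : ℕ) + 1)))
        + (1 + θ⁻¹) * ((B : ℝ) / d₀) * (∑ k : Fin B, ((2 * (π / 4 + (∑ k ∈ weilPrimeIndex a, (Λ k : ℝ) / Real.sqrt k) + a * (1 + weilArchDensity (2 * a)) / π) * (((k : ℕ) : ℝ) + 1) ^ (2 * J) / π + 4 * (Real.exp (a / 2) - Real.exp (-(a / 2))) ^ 2 / π * (a ^ 2 / (4 * π ^ 2)) ^ J * (freq a (((k : ℕ) : ℤ) + 1) / (1 + 4 * freq a (((k : ℕ) : ℤ) + 1) ^ 2)))) ^ 2 * x k ^ 2)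
          * (1 / ((4 * J + 1 : ℕ) * (B₃ : ℝ) ^ (4 * J + 1))) := by
  -- abbreviations
  set T := Finset.Ico B₃ N with hT
  have hB₃2 : 2 ≤ B₃ := by omega
  have hB0 : (0 : ℝ) < B := by exact_mod_cast hB
  set Fmode : ℤ → ℝ := fun n ↦ (Complex.digamma (1 / 4 + ((freq a n : ℝ) : ℂ) / 2 * I)).im / 2
      + (∑ k ∈ weilPrimeIndex a, (Λ k : ℝ) / Real.sqrt k * Real.sin (freq a n * Real.log k)) - archExpSumSin a n
    with hFmode
  set S2 : ℝ := (Real.exp (a / 2) - Real.exp (-(a / 2))) ^ 2 with hS2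
  set q : ℝ := a ^ 2 / (4 * π ^ 2) with hq
  set dfac : ℤ → ℝ := fun n ↦ freq a n / (1 + 4 * freq a n ^ 2) with hdfac
  -- row functionals (row k = mode k+1)
  set vA : Fin J → Fin B → ℝ := fun j k ↦ (-1 : ℝ) ^ ((k : ℕ) + 1) * (((k : ℕ) : ℝ) + 1) ^ (2 * (j : ℕ) + 1) with hvA
  set vB : Fin J → Fin B → ℝ := fun r k ↦ (-1 : ℝ) ^ ((k : ℕ) + 1) *
      (-((((k : ℕ) : ℝ) + 1) ^ (2 * (r : ℕ))) * Fmode (((k : ℕ) : ℤ) + 1) / π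
        - 4 * S2 / π * (-1 : ℝ) ^ (r : ℕ) * q ^ (r : ℕ) * dfac (((k : ℕ) : ℤ) + 1)) with hvB
  set αA : Fin J → ℝ := fun j ↦ ∑ k, vA j k * x k with hαA
  set αB : Fin J → ℝ := fun r ↦ ∑ k, vB r k * x k with hαB
  set ρ : Fin B → ℝ := fun k ↦ (2 * (π / 4 + (∑ k ∈ weilPrimeIndex a, (Λ k : ℝ) / Real.sqrt k)
        + a * (1 + weilArchDensity (2 * a)) / π) * (((k : ℕ) : ℝ) + 1) ^ (2 * J) / π
        + 4 * S2 / π * q ^ J * dfac (((k : ℕ) : ℤ) + 1)) with hρ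
  set bcol : ℕ → Fin B → ℝ := fun l k ↦
    ((gramCoeff a (((k : ℕ) : ℤ) + 1) ((l : ℤ) + 1) - gramCoeff a (((k : ℕ) : ℤ) + 1) (-((l : ℤ) + 1))) / 2) with hbcol
  -- per-mode facts
  have hTl : ∀ l ∈ T, B₃ ≤ l := fun l hl ↦ (Finset.mem_Ico.mp hl).1
  have key : ∀ l ∈ T, (∑ k, bcol l k * x k) ^ 2 / d l
      ≤ (1 + θ) * (1 / d₀) * (Fmode ((l : ℤ) + 1) / π * (∑ j, αA j / ((l : ℝ) + 1) ^ (2 * (j : ℕ) + 2))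
          + (∑ r, αB r / ((l : ℝ) + 1) ^ (2 * (r : ℕ) + 1))) ^ 2
        + (1 + θ⁻¹) * ((B : ℝ) / d₀) * (∑ k, ρ k ^ 2 * x k ^ 2) * (1 / (((l : ℝ) + 1) ^ (2 * J + 1)) ^ 2) := by
    intro l hl
    have hlB := hTl l hl
    have hl0 : (0 : ℝ) < (l : ℝ) + 1 := by positivity
    have hdl : d₀ ≤ d l := hd l hlB
    have hdpos : 0 < d l := lt_of_lt_of_le hd₀ hdl
    -- decomposition of the column sum (modes i = k+1, m = l+1)
    set R : ℝ := ∑ k, (bcol l k - (-1 : ℝ) ^ (l + 1) *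
        (Fmode ((l : ℤ) + 1) / π * ∑ j ∈ Finset.range J,
            ((-1 : ℝ) ^ ((k : ℕ) + 1) * (((k : ℕ) : ℝ) + 1) ^ (2 * j + 1)) / ((l : ℝ) + 1) ^ (2 * j + 2)
          + ∑ r ∈ Finset.range J, ((-1 : ℝ) ^ ((k : ℕ) + 1) *
              (-((((k : ℕ) : ℝ) + 1) ^ (2 * r)) * Fmode (((k : ℕ) : ℤ) + 1) / π
                - 4 * S2 / π * (-1 : ℝ) ^ r * q ^ r * dfac (((k : ℕ) : ℤ) + 1))) / ((l : ℝ) + 1) ^ (2 * r + 1)))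
        * x k with hR
    have hsplit : ∑ k, bcol l k * x k = (-1 : ℝ) ^ (l + 1) *
        (Fmode ((l : ℤ) + 1) / π * (∑ j, αA j / ((l : ℝ) + 1) ^ (2 * (j : ℕ) + 2))
          + (∑ r, αB r / ((l : ℝ) + 1) ^ (2 * (r : ℕ) + 1))) + R := by
      have ePA : (∑ j, αA j / ((l : ℝ) + 1) ^ (2 * (j : ℕ) + 2)) = ∑ k : Fin B, (∑ j ∈ Finset.range J,
          ((-1 : ℝ) ^ ((k : ℕ) + 1) * (((k : ℕ) : ℝ) + 1) ^ (2 * j + 1)) / ((l : ℝ) + 1) ^ (2 * j + 2)) * x k := by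
        simp only [hαA, hvA, Finset.sum_div]
        rw [Finset.sum_comm]
        refine Finset.sum_congr rfl fun k _ ↦ ?_
        rw [Finset.sum_mul, Finset.sum_range]
        refine Finset.sum_congr rfl fun j _ ↦ by ring
      have ePB : (∑ r, αB r / ((l : ℝ) + 1) ^ (2 * (r : ℕ) + 1)) = ∑ k : Fin B, (∑ r ∈ Finset.range J,
          ((-1 : ℝ) ^ ((k : ℕ) + 1) *
            (-((((k : ℕ) : ℝ) + 1) ^ (2 * r)) * Fmode (((k : ℕ) : ℤ) + 1) / π
              - 4 * S2 / π * (-1 : ℝ) ^ r * q ^ r * dfac (((k : ℕ) : ℤ) + 1))) / ((l : ℝ) + 1) ^ (2 * r + 1)) * x k := by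
        simp only [hαB, hvB, Finset.sum_div]
        rw [Finset.sum_comm]
        refine Finset.sum_congr rfl fun k _ ↦ ?_
        rw [Finset.sum_mul, Finset.sum_range]
        refine Finset.sum_congr rfl fun r _ ↦ by ring
      rw [ePA, ePB, hR, Finset.mul_sum, mul_add, Finset.mul_sum, Finset.mul_sum, ← Finset.sum_add_distrib,
        ← Finset.sum_add_distrib]
      refine Finset.sum_congr rfl fun k _ ↦ by ring
    -- the remainder bound per row, via the mode-level decomposition lemma
    have hrow : ∀ k : Fin B, abs (bcol l k - (-1 : ℝ) ^ (l + 1) *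
        (Fmode ((l : ℤ) + 1) / π * ∑ j ∈ Finset.range J,
            ((-1 : ℝ) ^ ((k : ℕ) + 1) * (((k : ℕ) : ℝ) + 1) ^ (2 * j + 1)) / ((l : ℝ) + 1) ^ (2 * j + 2)
          + ∑ r ∈ Finset.range J, ((-1 : ℝ) ^ ((k : ℕ) + 1) *
              (-((((k : ℕ) : ℝ) + 1) ^ (2 * r)) * Fmode (((k : ℕ) : ℤ) + 1) / π
                - 4 * S2 / π * (-1 : ℝ) ^ r * q ^ r * dfac (((k : ℕ) : ℤ) + 1))) / ((l : ℝ) + 1) ^ (2 * r + 1)))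
        ≤ ρ k / ((l : ℝ) + 1) ^ (2 * J + 1) := by
      intro k
      have him : 2 * ((k : ℕ) + 1) ≤ l + 1 := by have := k.isLt; omega
      have h := abs_oddKernel_col_sub_families_le ha (i := (k : ℕ) + 1) (m := l + 1) (by omega) him J
      simp only [hbcol, hFmode, hS2, hq, hdfac, hρ]
      push_cast at h ⊢
      exact h
    have hRsq : R ^ 2 ≤ (B : ℝ) * (∑ k, ρ k ^ 2 * x k ^ 2) * (1 / (((l : ℝ) + 1) ^ (2 * J + 1)) ^ 2) := by
      have h := sq_sum_mul_le_card_mul (ι := Fin B) _ (fun k ↦ ρ k / ((l : ℝ) + 1) ^ (2 * J + 1)) x hrow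
      simp only [Fintype.card_fin] at h
      refine h.trans (le_of_eq ?_)
      rw [mul_assoc, Finset.sum_mul]
      congr 1
      refine Finset.sum_congr rfl fun k _ ↦ ?_
      rw [div_pow]
      ring
    -- assemble: square, ONE Peter–Paul in θ, divide by d l ≥ d₀
    have hsq : (∑ k, bcol l k * x k) ^ 2
        ≤ (1 + θ) * (Fmode ((l : ℤ) + 1) / π * (∑ j, αA j / ((l : ℝ) + 1) ^ (2 * (j : ℕ) + 2)) + (∑ r, αB r / ((l : ℝ) + 1) ^ (2 * (r : ℕ) + 1))) ^ 2
          + (1 + θ⁻¹) * ((B : ℝ) * (∑ k, ρ k ^ 2 * x k ^ 2) * (1 / (((l : ℝ) + 1) ^ (2 * J + 1)) ^ 2)) := by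
      rw [hsplit]
      have hpp := sq_add_le_peterPaul (p := (-1 : ℝ) ^ (l + 1) * (Fmode ((l : ℤ) + 1) / π * (∑ j, αA j / ((l : ℝ) + 1) ^ (2 * (j : ℕ) + 2)) + (∑ r, αB r / ((l : ℝ) + 1) ^ (2 * (r : ℕ) + 1)))) (q := R) hθ
      have hsgn : ((-1 : ℝ) ^ (l + 1) * (Fmode ((l : ℤ) + 1) / π * (∑ j, αA j / ((l : ℝ) + 1) ^ (2 * (j : ℕ) + 2)) + (∑ r, αB r / ((l : ℝ) + 1) ^ (2 * (r : ℕ) + 1)))) ^ 2 = (Fmode ((l : ℤ) + 1) / π * (∑ j, αA j / ((l : ℝ) + 1) ^ (2 * (j : ℕ) + 2)) + (∑ r, αB r / ((l : ℝ) + 1) ^ (2 * (r : ℕ) + 1))) ^ 2 := by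
        rw [mul_pow, ← pow_mul, Even.neg_one_pow (by exact ⟨l + 1, by ring⟩), one_mul]
      rw [hsgn] at hpp
      have h2 : 0 ≤ 1 + θ⁻¹ := by positivity
      exact hpp.trans (add_le_add le_rfl (mul_le_mul_of_nonneg_left hRsq h2))
    have hnn : 0 ≤ (1 + θ) * (Fmode ((l : ℤ) + 1) / π * (∑ j, αA j / ((l : ℝ) + 1) ^ (2 * (j : ℕ) + 2)) + (∑ r, αB r / ((l : ℝ) + 1) ^ (2 * (r : ℕ) + 1))) ^ 2
          + (1 + θ⁻¹) * ((B : ℝ) * (∑ k, ρ k ^ 2 * x k ^ 2) * (1 / (((l : ℝ) + 1) ^ (2 * J + 1)) ^ 2)) := by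
      have : 0 ≤ ∑ k, ρ k ^ 2 * x k ^ 2 := Finset.sum_nonneg fun k _ ↦ by positivity
      positivity
    calc (∑ k, bcol l k * x k) ^ 2 / d l
        ≤ ((1 + θ) * (Fmode ((l : ℤ) + 1) / π * (∑ j, αA j / ((l : ℝ) + 1) ^ (2 * (j : ℕ) + 2)) + (∑ r, αB r / ((l : ℝ) + 1) ^ (2 * (r : ℕ) + 1))) ^ 2
          + (1 + θ⁻¹) * ((B : ℝ) * (∑ k, ρ k ^ 2 * x k ^ 2) * (1 / (((l : ℝ) + 1) ^ (2 * J + 1)) ^ 2))) / d l :=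
          div_le_div_of_nonneg_right hsq hdpos.le
      _ ≤ ((1 + θ) * (Fmode ((l : ℤ) + 1) / π * (∑ j, αA j / ((l : ℝ) + 1) ^ (2 * (j : ℕ) + 2)) + (∑ r, αB r / ((l : ℝ) + 1) ^ (2 * (r : ℕ) + 1))) ^ 2
          + (1 + θ⁻¹) * ((B : ℝ) * (∑ k, ρ k ^ 2 * x k ^ 2) * (1 / (((l : ℝ) + 1) ^ (2 * J + 1)) ^ 2))) / d₀ :=
          div_le_div_of_nonneg_left hnn hd₀ hdl
      _ = _ := by
          field_simp
  -- sum over the tail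
  have step1 : ∑ l ∈ T, (∑ k, bcol l k * x k) ^ 2 / d l
      ≤ (1 + θ) * (1 / d₀) * ∑ l ∈ T, (Fmode ((l : ℤ) + 1) / π * (∑ j, αA j / ((l : ℝ) + 1) ^ (2 * (j : ℕ) + 2)) + (∑ r, αB r / ((l : ℝ) + 1) ^ (2 * (r : ℕ) + 1))) ^ 2
        + (1 + θ⁻¹) * ((B : ℝ) / d₀) * (∑ k, ρ k ^ 2 * x k ^ 2) * ∑ l ∈ T, (1 / (((l : ℝ) + 1) ^ (2 * J + 1)) ^ 2) := by
    refine (Finset.sum_le_sum key).trans (le_of_eq ?_)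
    simp only [Finset.sum_add_distrib, ← Finset.mul_sum]
  -- reindex l + 1 = m ∈ Ico (B₃+1) (N+1): the structured sum and the joint bound at tail start B₃ + 1
  have hjoint0 := tailJJ_structured_le ha (by omega : 2 ≤ B₃ + 1) (fun j : Fin J ↦ 2 * (j : ℕ) + 2)
    (fun r' : Fin J ↦ 2 * (r' : ℕ) + 1) (fun j ↦ by omega) (fun r' ↦ by omega) (fun j ↦ (B : ℝ) ^ (2 * (j : ℕ) + 2))
    (fun r' ↦ (B : ℝ) ^ (2 * (r' : ℕ) + 1)) (fun j ↦ by positivity) (fun r' ↦ by positivity) s₁ sm sp hs₁ hsm hsp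
    (N + 1) αA αB
  have hre : ∑ l ∈ T, (Fmode ((l : ℤ) + 1) / π * (∑ j, αA j / ((l : ℝ) + 1) ^ (2 * (j : ℕ) + 2)) + (∑ r, αB r / ((l : ℝ) + 1) ^ (2 * (r : ℕ) + 1))) ^ 2
      = ∑ m ∈ Finset.Ico (B₃ + 1) (N + 1), (((Complex.digamma (1 / 4 + ((freq a m : ℝ) : ℂ) / 2 * I)).im / 2 + (∑ k ∈ weilPrimeIndex a, (Λ k : ℝ) / Real.sqrt k * Real.sin (freq a m * Real.log k)) - archExpSumSin a m) / π
          * (∑ j, αA j / (m : ℝ) ^ (2 * (j : ℕ) + 2)) + ∑ r', αB r' / (m : ℝ) ^ (2 * (r' : ℕ) + 1)) ^ 2 := by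
    rw [hT, ← Finset.sum_Ico_add' (c := 1)]
    refine Finset.sum_congr rfl fun l _ ↦ ?_
    simp only [hFmode]
    push_cast
    ring
  have hsumR0 := sum_Ico_one_div_pow_two_mul_le (E := 2 * J + 1) (by omega) (by omega : 2 ≤ B₃ + 1) (N + 1)
  have h4J : 2 * (2 * J + 1) - 1 = 4 * J + 1 := by omega
  rw [h4J] at hsumR0
  simp only [Nat.add_sub_cancel] at hjoint0 hsumR0
  have hreR : ∑ l ∈ T, 1 / (((l : ℝ) + 1) ^ (2 * J + 1)) ^ 2
      = ∑ m ∈ Finset.Ico (B₃ + 1) (N + 1), 1 / ((m : ℝ) ^ (2 * J + 1)) ^ 2 := by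
    rw [hT, ← Finset.sum_Ico_add' (c := 1)]
    refine Finset.sum_congr rfl fun l _ ↦ ?_
    push_cast
    ring
  have hjoint := (le_of_eq hre).trans hjoint0
  have hR' := (le_of_eq hreR).trans hsumR0
  have hcJ : 0 ≤ (1 + θ) * (1 / d₀) := by positivity
  have hcR : 0 ≤ (1 + θ⁻¹) * ((B : ℝ) / d₀) * (∑ k, ρ k ^ 2 * x k ^ 2) := by
    have : 0 ≤ ∑ k, ρ k ^ 2 * x k ^ 2 := Finset.sum_nonneg fun k _ ↦ by positivity
    positivity
  have step2 := add_le_add (mul_le_mul_of_nonneg_left hjoint hcJ) (mul_le_mul_of_nonneg_left hR' hcR)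
  have hfin := step1.trans step2
  simp only [hT, hbcol, hαA, hαB, hvA, hvB, hρ, hFmode, hS2, hq, hdfac] at hfin
  exact hfin

end Tail

end Summit.RiemannHypothesis.RiemannHypothesis.Theorems.WeilFormatC

end
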